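import Literature.MathematicalPhysics.QuantumLattice.BalabanRGHaarIterates
import Mathlib.MeasureTheory.Integral.Marginal
import Mathlib.MeasureTheory.Integral.MeanInequalities
import HarnessLib

/-!
# The spread twist: changing a block holonomy by moving every link of its line a little

Companion of prelude A18 `Literature/MathematicalPhysics/QuantumLattice/BalabanRG.lean` and of
`BalabanRGHaarIterates.lean` (the explicit block RG step density `blockStepDensity` and its
pushforward formula). Everything here is proved; no proposition is defined and no named fact is
introduced. The two definitions (`lineTail`, `spreadTwist`, plus the auxiliary `twistSlot`,
`twistUpTo`) are concrete maps on lattice gauge configurations.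

## The mechanism

`BalabanRGHaarIterates` bounds the oscillation of the block RG step density
`D(V) = ∫ w(firstLift (V Ū⁻¹) U) dU` by moving the prescribed twist of a block holonomy onto the
FIRST link of the block line: the weight changes by at most `e^{K}` per coarse edge with
`K ∝ β ×` (plaquettes per link) — a constant proportional to the inverse bare coupling `β`.
Here the twist is instead SPREAD over all `L` links of the line: to multiply the block holonomy
of the coarse edge `b` by `s ^ L` on the right, every line edge `e_t` is right-multiplied by the
conjugate `Q_t s Q_t⁻¹` of `s` by the tail holonomy `Q_t = U(e_{t+1}) ⋯ U(e_{L-1})`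
(`spreadTwist`; the tails telescope, `axialBlockHolonomy_spreadTwist`). This map

* preserves the free Haar reference measure `freeHaarConfig (fineEdges L Λ)` — it is a composite
  of `L` skew right translations, each multiplier reading only links not yet moved
  (`twistUpTo_eq_spreadTwist`, `measurePreserving_update_mul_pi`,
  `measurePreserving_spreadTwist`);
* commutes with the first-link lifts of `blockStepDensity` (`spreadTwist_firstLift_mul`), so that
  it intertwines the fibre maps EXACTLY: `Φ_{V·[b ↦ s^L]} ∘ T_s = T_s ∘ Φ_V`
  (`firstLift_mul_spreadTwist`), whence `D(V · [b ↦ s^L]) = ∫ w (T_s (Φ_V U)) dU`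
  (`blockStepDensity_mul_mulSingle_pow`).

Applying this with `s` and with `s⁻¹` (same tails) and the Cauchy–Schwarz inequality gives the
**two-sided twist inequality** `a · D(V) ≤ D(V·[b ↦ s^L])^{1/2} · D(V·[b ↦ s^{-L}])^{1/2}`
whenever `a · w ≤ (w ∘ T_s)^{1/2} (w ∘ T_{s⁻¹})^{1/2}` pointwise
(`mul_blockStepDensity_le_sqrt_mul_sqrt`) — for `w = e^{-β S}` the hypothesis is a bound on the
SYMMETRIC SECOND DIFFERENCE `S ∘ T_s + S ∘ T_{s⁻¹} - 2 S`, in which first-order terms cancel.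
A supremum argument on each fibre `x ↦ D(V[b ↦ x])` (`sq_mul_le_of_forall_exists_sqrt`: no
maximiser is chosen) and a coordinate-by-coordinate chain turn this into the oscillation
hypothesis `hosc` of `bounds_of_osc_of_lintegral_eq_one` with constant `K = -2 log a` per coarse
edge (`blockStepDensity_osc_of_twist`), provided every target `x ∈ G` has an `L`-th root `s` for
which the pointwise bound holds. For `G = SU(2)` and the Wilson weight at `β = L / g²` such roots
exist with `K = O(g⁻²)` INDEPENDENT of `L` (sibling file
`QuantumFieldTheory/ConstructiveQFTBalabanRGStability3Proofs`): each link moves by `O(L⁻¹)`, the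
second difference is `O(L · L⁻²)` per line, and `β · L⁻¹ = g⁻²`.

## What this is not

This is an elementary convexity-plus-Haar-invariance argument in the free-boundary straight-line
set-up of prelude A18. It is NOT Bałaban's renormalization group analysis (CMP 95–102,
1984–85: gauge-covariant averages, background fields, small/large-field decomposition), and it
says nothing about the form of the effective action; it only controls the oscillation of the
block RG transform of a log-bounded-second-difference weight.

## References

* T. Bałaban, *Propagators and renormalization transformations for lattice gauge theories. I*,
  Comm. Math. Phys. 95 (1984) 17–40, §1 (block lines, axial-gauge block variables).
* T. Bałaban, *Ultraviolet stability of three-dimensional lattice pure gauge field theories*,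
  Comm. Math. Phys. 102 (1985) 255–275 (the stability bounds whose rendered form this serves).
* E. Seiler, *Gauge Theories as a Problem of Constructive Quantum Field Theory and Statistical
  Mechanics*, LNP 159 (1982), Ch. 2 (link-by-link Haar changes of variables).
-/

noncomputable section

open MeasureTheory Filter Finset Function
open scoped ENNReal

namespace Literature.MathematicalPhysics.QuantumLattice

open Literature.Probability.LatticeModels

variable {d N : ℕ} {G : Type*}

/-! ### Tails of a block line and the spread twist -/

section Algebra

variable [Group G]

/-- The **tail holonomy** `Q_t(U) = U(e_{t+1}) U(e_{t+2}) ⋯ U(e_{L-1})` of the block line of the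
coarse edge `b` (`e_j = lineEdge L b j`): the parallel transport from the end point of the
`t`-th line edge to the far corner of the line (Bałaban CMP 95 (1984) §1, (1.5), partial
contour holonomies). For `t + 1 ≥ L` it is the empty product `1`. [folklore] -/
def lineTail (L : ℕ) (b : ZdEdge d) (U : LGConfig d G) (t : ℕ) : G :=
  ((List.Ico (t + 1) L).map fun j => U (lineEdge L b j)).prod

/-- The tail holonomy `Q_t` reads the configuration only on the later line edges `e_j`,
`t < j < L`. [folklore] -/
theorem lineTail_congr (L : ℕ) (b : ZdEdge d) {U U' : LGConfig d G} (t : ℕ)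
    (h : ∀ j, t < j → j < L → U (lineEdge L b j) = U' (lineEdge L b j)) :
    lineTail L b U t = lineTail L b U' t := by
  unfold lineTail
  congr 1
  refine List.map_congr_left fun j hj => ?_
  rw [List.Ico.mem] at hj
  exact h j hj.1 hj.2

open Classical in
/-- The **spread twist** `T_s` of the block line of `b` by the group element `s`: every line edge
`e_t = lineEdge L b t`, `t < L`, is right-multiplied by the conjugate `Q_t s Q_t⁻¹` of `s` by
the tail holonomy `Q_t = lineTail L b U t`; all other edges are unchanged. In words: the line
holonomy is changed by `s` at EVERY link, each time transported to the far corner, so that the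
total change of the block holonomy is `s ^ L` on the right (`axialBlockHolonomy_spreadTwist`)
while each individual link moves only by (a conjugate of) `s`. This is the change of variables
behind the cutoff-uniform stability bound of the sibling file: for `s` an `L`-th root close to
`1` of a prescribed twist, the Wilson action changes to second order only by `O(L · L⁻²)` per
line. Elementary; not in the sources in this form (Bałaban works with gauge-covariant averages
and background fields instead, CMP 95 (1984) §1, CMP 102 (1985) §1). [folklore] -/
def spreadTwist (L : ℕ) (b : ZdEdge d) (s : G) (U : LGConfig d G) : LGConfig d G :=
  fun e => if h : ∃ t, t < L ∧ e = lineEdge L b t then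
    U e * (lineTail L b U (Classical.choose h) * s * (lineTail L b U (Classical.choose h))⁻¹)
  else U e

/-- The spread twist on a line edge: `(T_s U)(e_t) = U(e_t) · Q_t s Q_t⁻¹`. [folklore] -/
theorem spreadTwist_lineEdge (L : ℕ) (b : ZdEdge d) (s : G) (U : LGConfig d G) {t : ℕ}
    (ht : t < L) :
    spreadTwist L b s U (lineEdge L b t) =
      U (lineEdge L b t) * (lineTail L b U t * s * (lineTail L b U t)⁻¹) := by
  classical
  have h : ∃ t', t' < L ∧ lineEdge L b t = lineEdge L b t' := ⟨t, ht, rfl⟩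
  unfold spreadTwist
  rw [dif_pos h]
  have hspec := Classical.choose_spec h
  rw [← (lineEdge_inj ht hspec.1 hspec.2).2]

/-- Off the line of `b` the spread twist does nothing. [folklore] -/
theorem spreadTwist_apply_of_forall_ne (L : ℕ) (b : ZdEdge d) (s : G) (U : LGConfig d G)
    {e : ZdEdge d} (h : ∀ t, t < L → e ≠ lineEdge L b t) : spreadTwist L b s U e = U e := by
  classical
  unfold spreadTwist
  rw [dif_neg]
  rintro ⟨t, ht, rfl⟩
  exact h t ht rfl

/-- The spread twist changes the configuration only on `fineEdges L {b}` (the line of `b` lies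
over `b`). [folklore] -/
theorem spreadTwist_apply_of_not_mem (L : ℕ) [NeZero L] (b : ZdEdge d) (s : G) (U : LGConfig d G)
    {e : ZdEdge d} (he : e ∉ fineEdges L {b}) : spreadTwist L b s U e = U e := by
  refine spreadTwist_apply_of_forall_ne L b s U fun t ht h => he ?_
  rw [h, lineEdge_mem_fineEdges_iff L {b} b ht]
  exact mem_singleton_self b

/-- Telescoping along a line: right-multiplying the `t`-th factor of an ordered product by the
conjugate `Q_t s Q_t⁻¹` of `s` by the tail product `Q_t = f(t+1) ⋯ f(L-1)`, for every `t`,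
multiplies the whole product by `s ^ L` on the right (the tail products telescope). [folklore] -/
theorem prod_map_range_mul_conj_tail (f : ℕ → G) (s : G) (L : ℕ) :
    ((List.range L).map fun t => f t *
        (((List.Ico (t + 1) L).map f).prod * s * (((List.Ico (t + 1) L).map f).prod)⁻¹)).prod =
      ((List.range L).map f).prod * s ^ L := by
  -- descending induction over final segments `Ico (L - k) L`
  suffices h : ∀ k, k ≤ L →
      ((List.Ico (L - k) L).map fun t => f t *
        (((List.Ico (t + 1) L).map f).prod * s * (((List.Ico (t + 1) L).map f).prod)⁻¹)).prod =
      ((List.Ico (L - k) L).map f).prod * s ^ k by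
    simpa [List.Ico.zero_bot] using h L le_rfl
  intro k hk
  induction k with
  | zero => simp [List.Ico.self_empty]
  | succ k ih =>
    have hlt : L - (k + 1) < L := by omega
    have heq : L - (k + 1) + 1 = L - k := by omega
    rw [List.Ico.eq_cons hlt]
    simp only [List.map_cons, List.prod_cons, heq]
    rw [ih (by omega), pow_succ']
    simp only [mul_assoc, inv_mul_cancel_left]

/-- **The spread twist multiplies the block holonomy by `s ^ L` on the right** (on the coarse
edge `b`; all other block holonomies are unchanged): `hol (T_s U) = hol U · [b ↦ s ^ L]`
(telescoping of the tail holonomies, `prod_map_range_mul_conj_tail`). [folklore] -/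
theorem axialBlockHolonomy_spreadTwist (L : ℕ) (b : ZdEdge d) (s : G) (U : LGConfig d G) :
    axialBlockHolonomy L (spreadTwist L b s U) = axialBlockHolonomy L U * Pi.mulSingle b (s ^ L) := by
  funext b'
  rw [Pi.mul_apply, axialBlockHolonomy_apply, axialBlockHolonomy_apply]
  by_cases hb : b' = b
  · subst hb
    rw [Pi.mulSingle_eq_same]
    have : ((List.range L).map fun t => spreadTwist L b' s U (lineEdge L b' t)) =
        (List.range L).map fun t => U (lineEdge L b' t) *
          (((List.Ico (t + 1) L).map fun j => U (lineEdge L b' j)).prod * s *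
            (((List.Ico (t + 1) L).map fun j => U (lineEdge L b' j)).prod)⁻¹) := by
      refine List.map_congr_left fun t ht => ?_
      rw [spreadTwist_lineEdge L b' s U (List.mem_range.1 ht)]
      rfl
    rw [this]
    exact prod_map_range_mul_conj_tail (fun j => U (lineEdge L b' j)) s L
  · rw [Pi.mulSingle_eq_of_ne hb, mul_one]
    congr 1
    refine List.map_congr_left fun t ht => ?_
    refine spreadTwist_apply_of_forall_ne L b s U fun t' ht' h => hb ?_
    exact (lineEdge_inj (List.mem_range.1 ht) ht' h).1

/-- The tail holonomies do not see the first links: `Q_t(firstLift c · U) = Q_t(U)`. [folklore] -/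
theorem lineTail_firstLift_mul (L : ℕ) (Λ : Finset (ZdEdge d)) (b : ZdEdge d)
    (c U : LGConfig d G) (t : ℕ) :
    lineTail L b (firstLift L Λ c * U) t = lineTail L b U t := by
  refine lineTail_congr L b t fun j hj hjL => ?_
  obtain ⟨j', rfl⟩ : ∃ j', j = j' + 1 := ⟨j - 1, by omega⟩
  rw [Pi.mul_apply, firstLift_lineEdge_succ L Λ c b hjL, one_mul]

/-- **The spread twist commutes with first-link lifts**: `T_s (firstLift c · U) = firstLift c · T_s U`
(the lift acts on first links by left multiplication, the twist by right multiplication with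
multipliers reading only later links). This is what makes the fibre maps
`U ↦ firstLift (V · Ū⁻¹) · U` of `blockStepDensity` equivariant under the twist. [folklore] -/
theorem spreadTwist_firstLift_mul (L : ℕ) (Λ : Finset (ZdEdge d)) (b : ZdEdge d) (s : G)
    (c U : LGConfig d G) :
    spreadTwist L b s (firstLift L Λ c * U) = firstLift L Λ c * spreadTwist L b s U := by
  funext e
  by_cases h : ∃ t, t < L ∧ e = lineEdge L b t
  · obtain ⟨t, ht, rfl⟩ := h
    rw [spreadTwist_lineEdge L b s _ ht, Pi.mul_apply, Pi.mul_apply, spreadTwist_lineEdge L b s _ ht,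
      lineTail_firstLift_mul, mul_assoc]
  · push Not at h
    rw [spreadTwist_apply_of_forall_ne L b s _ h, Pi.mul_apply, Pi.mul_apply,
      spreadTwist_apply_of_forall_ne L b s _ h]

end Algebra

/-! ### The spread twist as a composition of single-link maps; measurability -/

section Slots

variable [Group G]

/-- The single-link map `R_t`: right-multiply the `t`-th line edge by `Q_t s Q_t⁻¹`. [folklore] -/
def twistSlot (L : ℕ) (b : ZdEdge d) (s : G) (t : ℕ) (U : LGConfig d G) : LGConfig d G :=
  update U (lineEdge L b t) (U (lineEdge L b t) * (lineTail L b U t * s * (lineTail L b U t)⁻¹))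

/-- The partial composites `R_{m-1} ∘ ⋯ ∘ R_0` of the single-link maps. [folklore] -/
def twistUpTo (L : ℕ) (b : ZdEdge d) (s : G) : ℕ → LGConfig d G → LGConfig d G
  | 0 => id
  | m + 1 => twistSlot L b s m ∘ twistUpTo L b s m

/-- The partial composite `R_{m-1} ∘ ⋯ ∘ R_0` (`m ≤ L`) agrees with the spread twist on the first
`m` line edges and with the original configuration elsewhere: applying the single-link maps in
increasing order, each multiplier `Q_t s Q_t⁻¹` still reads the ORIGINAL later links. [folklore] -/
theorem twistUpTo_apply (L : ℕ) (b : ZdEdge d) (s : G) {m : ℕ} (hm : m ≤ L) (U : LGConfig d G)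
    (e : ZdEdge d) :
    twistUpTo L b s m U e =
      if ∃ t, t < m ∧ e = lineEdge L b t then spreadTwist L b s U e else U e := by
  classical
  induction m generalizing e with
  | zero => simp [twistUpTo]
  | succ m ih =>
    have hmL : m < L := hm
    have ih' := ih hmL.le
    rw [twistUpTo, comp_apply, twistSlot]
    by_cases he : e = lineEdge L b m
    · subst he
      rw [update_self, if_pos ⟨m, m.lt_succ_self, rfl⟩, spreadTwist_lineEdge L b s U hmL]
      have h1 : twistUpTo L b s m U (lineEdge L b m) = U (lineEdge L b m) := by
        rw [ih', if_neg]
        rintro ⟨t, ht, h⟩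
        exact absurd (lineEdge_inj hmL (ht.trans hmL) h).2 ht.ne'
      have h2 : lineTail L b (twistUpTo L b s m U) m = lineTail L b U m := by
        refine lineTail_congr L b m fun j hj hjL => ?_
        rw [ih', if_neg]
        rintro ⟨t, ht, h⟩
        have := (lineEdge_inj hjL (ht.trans hmL) h).2
        omega
      rw [h1, h2]
    · rw [update_of_ne he, ih']
      have hiff : (∃ t, t < m + 1 ∧ e = lineEdge L b t) ↔ ∃ t, t < m ∧ e = lineEdge L b t := by
        constructor
        · rintro ⟨t, ht, rfl⟩
          rcases Nat.lt_succ_iff_lt_or_eq.1 ht with h | rfl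
          · exact ⟨t, h, rfl⟩
          · exact absurd rfl he
        · rintro ⟨t, ht, rfl⟩
          exact ⟨t, Nat.lt_succ_of_lt ht, rfl⟩
      by_cases h' : ∃ t, t < m ∧ e = lineEdge L b t
      · rw [if_pos h', if_pos (hiff.2 h')]
      · rw [if_neg h', if_neg (mt hiff.1 h')]

/-- **The spread twist is the composite of the `L` single-link maps** `R_{L-1} ∘ ⋯ ∘ R_0`. [folklore] -/
theorem twistUpTo_eq_spreadTwist (L : ℕ) (b : ZdEdge d) (s : G) :
    twistUpTo L b s L = spreadTwist L b s := by
  funext U e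
  rw [twistUpTo_apply L b s le_rfl]
  split_ifs with h
  · rfl
  · push Not at h
    exact (spreadTwist_apply_of_forall_ne L b s U h).symm

variable [MeasurableSpace G] [MeasurableMul₂ G]

/-- The tail holonomy is a measurable function of the configuration. [folklore] -/
theorem measurable_lineTail (L : ℕ) (b : ZdEdge d) (t : ℕ) :
    Measurable fun U : LGConfig d G => lineTail L b U t := by
  unfold lineTail
  have : (fun U : LGConfig d G => ((List.Ico (t + 1) L).map fun j => U (lineEdge L b j)).prod) =
      fun U => (((List.Ico (t + 1) L).map fun j => fun U : LGConfig d G => U (lineEdge L b j)).map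
        fun f => f U).prod := by
    funext U
    rw [List.map_map]
    rfl
  rw [this]
  refine List.measurable_fun_prod _ fun f hf => ?_
  obtain ⟨j, -, rfl⟩ := List.mem_map.1 hf
  exact measurable_pi_apply _

/-- The single-link maps are measurable. [folklore] -/
theorem measurable_twistSlot [MeasurableInv G] (L : ℕ) (b : ZdEdge d) (s : G) (t : ℕ) :
    Measurable (twistSlot (d := d) L b s t) := by
  classical
  unfold twistSlot
  refine measurable_pi_lambda _ fun e => ?_
  by_cases he : e = lineEdge L b t
  · subst he
    simp only [update_self]
    exact (measurable_pi_apply _).mul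
      ((((measurable_lineTail L b t).mul_const s).mul (measurable_lineTail L b t).inv))
  · simp only [update_of_ne he]
    exact measurable_pi_apply _

/-- The partial composites are measurable. [folklore] -/
theorem measurable_twistUpTo [MeasurableInv G] (L : ℕ) (b : ZdEdge d) (s : G) (m : ℕ) :
    Measurable (twistUpTo (d := d) L b s m) := by
  induction m with
  | zero => exact measurable_id
  | succ m ih => exact (measurable_twistSlot L b s m).comp ih

/-- The spread twist is measurable. [folklore] -/
theorem measurable_spreadTwist [MeasurableInv G] (L : ℕ) (b : ZdEdge d) (s : G) :
    Measurable (spreadTwist (d := d) L b s) := by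
  rw [← twistUpTo_eq_spreadTwist]
  exact measurable_twistUpTo L b s L

end Slots

/-! ### Haar invariance of the spread twist -/

section Haar

variable [Group G] [MeasurableSpace G] [TopologicalSpace G] [IsTopologicalGroup G]
  [CompactSpace G] [BorelSpace G]

/-- **Skew translations preserve product Haar measure.** On a finite product of copies of the
compact group `G` with product Haar probability measure, right-multiplying ONE coordinate by a
measurable function of the OTHER coordinates, `u ↦ update u i (u i · ψ u)` with `ψ` blind to the
`i`-th coordinate, is measure preserving: integrate the `i`-th coordinate first (Mathlib
`lmarginal_singleton`) and use right invariance of Haar measure on the compact (unimodular) group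
(`measurePreserving_mul_mul_inv_haarProbability`) (Fubini; Seiler LNP 159 Ch. 2, the standard
link-by-link change of variables of lattice gauge theory). [folklore] -/
theorem measurePreserving_update_mul_pi {ι : Type*} [Fintype ι] [DecidableEq ι]
    [MeasurableMul₂ G] (i : ι) {ψ : (ι → G) → G} (hψ : Measurable ψ)
    (hψi : ∀ u x, ψ (update u i x) = ψ u) :
    MeasurePreserving (fun u : ι → G => update u i (u i * ψ u))
      (Measure.pi fun _ : ι => QuantumFieldTheory.haarProbability G)
      (Measure.pi fun _ : ι => QuantumFieldTheory.haarProbability G) := by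
  set S : (ι → G) → (ι → G) := fun u => update u i (u i * ψ u) with hS_def
  have hS : Measurable S := by
    refine measurable_pi_lambda _ fun j => ?_
    by_cases hj : j = i
    · subst hj
      simp only [hS_def, update_self]
      exact (measurable_pi_apply _).mul hψ
    · simp only [hS_def, update_of_ne hj]
      exact measurable_pi_apply _
  have key : ∀ f : (ι → G) → ℝ≥0∞, Measurable f →
      ∫⁻ u, f (S u) ∂Measure.pi (fun _ : ι => QuantumFieldTheory.haarProbability G) =
        ∫⁻ u, f u ∂Measure.pi (fun _ : ι => QuantumFieldTheory.haarProbability G) := by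
    intro f hf
    refine lintegral_eq_of_lmarginal_eq {i} (hf.comp hS) hf ?_
    funext x
    rw [lmarginal_singleton, lmarginal_singleton]
    have h1 : ∀ z, S (update x i z) = update x i (z * ψ x) := by
      intro z
      simp only [hS_def, update_self, update_idem, hψi]
    simp only [h1]
    have hmp : MeasurePreserving (fun z : G => z * ψ x) (QuantumFieldTheory.haarProbability G)
        (QuantumFieldTheory.haarProbability G) := by
      have h := measurePreserving_mul_mul_inv_haarProbability (1 : G) (ψ x)⁻¹
      have hfun : (fun z : G => 1 * z * (ψ x)⁻¹⁻¹) = fun z => z * ψ x := by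
        funext z; rw [one_mul, inv_inv]
      rwa [hfun] at h
    exact hmp.lintegral_comp (hf.comp (measurable_update x))
  refine ⟨hS, Measure.ext fun A hA => ?_⟩
  rw [Measure.map_apply hS hA, ← lintegral_indicator_one (hS hA), ← lintegral_indicator_one hA,
    ← key _ (measurable_one.indicator hA)]
  rfl

variable [MeasurableMul₂ G] [MeasurableInv G]

omit [MeasurableSpace G] [TopologicalSpace G] [IsTopologicalGroup G] [CompactSpace G] [BorelSpace G]
  [MeasurableMul₂ G] [MeasurableInv G] in
/-- Gluing commutes with updating a coordinate inside the volume. [folklore] -/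
theorem glueWith_update_one {F : Finset (ZdEdge d)} (u : ↥F → G) (i : ↥F) (x : G) :
    glueWith F (update u i x) (1 : LGConfig d G) = update (glueWith F u 1) i.1 x := by
  classical
  funext e
  by_cases he : e ∈ F
  · rw [glueWith_apply_mem _ _ _ he]
    by_cases hei : (⟨e, he⟩ : ↥F) = i
    · rw [hei, update_self, show e = i.1 from congrArg Subtype.val hei, update_self]
    · rw [update_of_ne hei, update_of_ne (fun h => hei (Subtype.ext h)), glueWith_apply_mem _ _ _ he]
  · have hne : e ≠ i.1 := fun h => he (h ▸ i.2)
    rw [glueWith_apply_not_mem _ _ _ he, update_of_ne hne, glueWith_apply_not_mem _ _ _ he]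

/-- **The single-link maps preserve the free Haar reference measure** `freeHaarConfig (fineEdges L Λ)`
(for `b ∈ Λ`, `t < L`): transported to the finite product `Haar^{⊗ fineEdges L Λ}` they are skew
right translations of the coordinate `e_t` by a function of the later line edges
(`measurePreserving_update_mul_pi`). [folklore] -/
theorem measurePreserving_twistSlot (L : ℕ) [NeZero L] (Λ : Finset (ZdEdge d)) {b : ZdEdge d}
    (hb : b ∈ Λ) (s : G) {t : ℕ} (ht : t < L) :
    MeasurePreserving (twistSlot L b s t) (freeHaarConfig (fineEdges L Λ))
      (freeHaarConfig (fineEdges L Λ)) := by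
  classical
  set F := fineEdges L Λ with hF
  have hi : lineEdge L b t ∈ F := (lineEdge_mem_fineEdges_iff L Λ b ht).2 hb
  set i : ↥F := ⟨lineEdge L b t, hi⟩ with hi_def
  set gl : (↥F → G) → LGConfig d G := fun u => glueWith F u (1 : LGConfig d G) with hgl_def
  have hgl : Measurable gl := measurable_glueWith _ _
  -- the multiplier, read through the gluing
  set ψ : (↥F → G) → G := fun u => lineTail L b (gl u) t * s * (lineTail L b (gl u) t)⁻¹ with hψ_def
  have hψ : Measurable ψ :=
    (((measurable_lineTail L b t).comp hgl).mul_const s).mul ((measurable_lineTail L b t).comp hgl).inv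
  have hψi : ∀ u x, ψ (update u i x) = ψ u := by
    intro u x
    have htail : lineTail L b (gl (update u i x)) t = lineTail L b (gl u) t := by
      refine lineTail_congr L b t fun j hj hjL => ?_
      simp only [hgl_def]
      rw [glueWith_update_one, update_of_ne]
      intro h
      exact absurd (lineEdge_inj hjL ht h).2 hj.ne'
    simp only [hψ_def, htail]
  have hcomm : twistSlot L b s t ∘ gl = gl ∘ fun u => update u i (u i * ψ u) := by
    funext u
    simp only [comp_apply, twistSlot, hgl_def]
    rw [glueWith_update_one, glueWith_apply_mem _ _ _ hi]
  refine ⟨measurable_twistSlot L b s t, ?_⟩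
  change Measure.map _ (Measure.map gl _) = Measure.map gl _
  rw [Measure.map_map (measurable_twistSlot L b s t) hgl, hcomm, ← Measure.map_map hgl
    (measurePreserving_update_mul_pi i hψ hψi).measurable,
    (measurePreserving_update_mul_pi i hψ hψi).map_eq]

/-- The partial composites preserve the free Haar reference measure. [folklore] -/
theorem measurePreserving_twistUpTo (L : ℕ) [NeZero L] (Λ : Finset (ZdEdge d)) {b : ZdEdge d}
    (hb : b ∈ Λ) (s : G) {m : ℕ} (hm : m ≤ L) :
    MeasurePreserving (twistUpTo L b s m) (freeHaarConfig (fineEdges L Λ))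
      (freeHaarConfig (fineEdges L Λ)) := by
  induction m with
  | zero => exact MeasurePreserving.id _
  | succ m ih =>
    exact (measurePreserving_twistSlot L Λ hb s (Nat.lt_of_succ_le hm)).comp (ih (Nat.le_of_succ_le hm))

/-- **Haar invariance of the spread twist**: for `b ∈ Λ`, the spread twist `T_s` of the line of
`b` preserves the free-boundary reference measure `freeHaarConfig (fineEdges L Λ)` — it is the
composite of `L` skew right translations, applied from the first link to the last, each
multiplier reading only links not yet modified (`twistUpTo_eq_spreadTwist`,
`measurePreserving_twistSlot`). [folklore] -/
theorem measurePreserving_spreadTwist (L : ℕ) [NeZero L] (Λ : Finset (ZdEdge d)) {b : ZdEdge d}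
    (hb : b ∈ Λ) (s : G) :
    MeasurePreserving (spreadTwist L b s) (freeHaarConfig (fineEdges L Λ))
      (freeHaarConfig (fineEdges L Λ)) := by
  rw [← twistUpTo_eq_spreadTwist]
  exact measurePreserving_twistUpTo L Λ hb s le_rfl

end Haar

/-! ### Convexity: the two-sided twist inequality for the block RG step density -/

section Convexity

variable [Group G] [MeasurableSpace G] [TopologicalSpace G] [IsTopologicalGroup G]
  [CompactSpace G] [BorelSpace G] [MeasurableMul₂ G] [MeasurableInv G]

omit [MeasurableSpace G] [TopologicalSpace G] [IsTopologicalGroup G] [CompactSpace G] [BorelSpace G]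
  [MeasurableMul₂ G] [MeasurableInv G] in
/-- **Exact intertwining of the fibre maps by the spread twist.** The map
`Φ_V : U ↦ firstLift (V · Ū⁻¹) · U` used in `blockStepDensity` (it moves `U` into the fibre
`{hol = V}` by adjusting first links) satisfies `Φ_{V · [b ↦ s^L]} ∘ T_s = T_s ∘ Φ_V`: the twist
multiplies the holonomy by `s ^ L` on the right (`axialBlockHolonomy_spreadTwist`) and commutes
with first-link lifts (`spreadTwist_firstLift_mul`). [folklore] -/
theorem firstLift_mul_spreadTwist (L : ℕ) [NeZero L] (Λ : Finset (ZdEdge d)) (b : ZdEdge d) (s : G)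
    (V U : LGConfig d G) :
    firstLift L Λ ((V * Pi.mulSingle b (s ^ L)) * (axialBlockHolonomy L (spreadTwist L b s U))⁻¹) *
        spreadTwist L b s U =
      spreadTwist L b s (firstLift L Λ (V * (axialBlockHolonomy L U)⁻¹) * U) := by
  rw [axialBlockHolonomy_spreadTwist, mul_inv_rev, mul_assoc, mul_inv_cancel_left,
    spreadTwist_firstLift_mul]

/-- The block RG step density at the twisted coarse field is the average of the weight over the
twisted fibre: `D(V · [b ↦ s^L]) = ∫ w (T_s (Φ_V U)) dU` (Haar invariance of `T_s`,
`measurePreserving_spreadTwist`, and the intertwining `firstLift_mul_spreadTwist`). [folklore] -/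
theorem blockStepDensity_mul_mulSingle_pow (L : ℕ) [NeZero L] (Λ : Finset (ZdEdge d)) {b : ZdEdge d}
    (hb : b ∈ Λ) (s : G) {w : LGConfig d G → ℝ≥0∞} (hw : Measurable w) (V : LGConfig d G) :
    blockStepDensity L Λ w (V * Pi.mulSingle b (s ^ L)) =
      ∫⁻ U, w (spreadTwist L b s (firstLift L Λ (V * (axialBlockHolonomy L U)⁻¹) * U))
        ∂freeHaarConfig (fineEdges L Λ) := by
  unfold blockStepDensity
  have hmeas : Measurable fun U : LGConfig d G =>
      w (firstLift L Λ ((V * Pi.mulSingle b (s ^ L)) * (axialBlockHolonomy L U)⁻¹) * U) :=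
    hw.comp (((measurable_firstLift L Λ).comp
      (measurable_const.mul (measurable_axialBlockHolonomy L).inv)).mul measurable_id)
  rw [← (measurePreserving_spreadTwist L Λ hb s).lintegral_comp hmeas]
  refine lintegral_congr fun U => ?_
  rw [firstLift_mul_spreadTwist]

/-- **The two-sided twist (convexity) inequality.** If the weight satisfies the pointwise
geometric-mean bound `a · w(U) ≤ w(T_s U)^{1/2} · w(T_{s⁻¹} U)^{1/2}` for the spread twists by `s`
and by `s⁻¹` (for the Wilson weight `e^{-β S}` this says that the symmetric second difference
`S(T_s U) + S(T_{s⁻¹} U) - 2 S(U)` is bounded above by `-2 β⁻¹ log a`), then the block RG step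
density satisfies `a · D(V) ≤ D(V · [b ↦ s^L])^{1/2} · D(V · [b ↦ s^{-L}])^{1/2}` for EVERY coarse
field `V`: Cauchy–Schwarz (Mathlib's Hölder inequality `ENNReal.lintegral_mul_le_Lp_mul_Lq` with
`p = q = 2`) on the fibre representation `blockStepDensity_mul_mulSingle_pow`. No expansion, no
small-field condition: this is the convexity of `t ↦ log ∫ e^{-t f}`, in multiplicative form. [folklore] -/
theorem mul_blockStepDensity_le_sqrt_mul_sqrt (L : ℕ) [NeZero L] (Λ : Finset (ZdEdge d))
    {b : ZdEdge d} (hb : b ∈ Λ) (s : G) {w : LGConfig d G → ℝ≥0∞} (hw : Measurable w) {a : ℝ≥0∞}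
    (hpt : ∀ U, a * w U ≤
      (w (spreadTwist L b s U)) ^ (1 / 2 : ℝ) * (w (spreadTwist L b s⁻¹ U)) ^ (1 / 2 : ℝ))
    (V : LGConfig d G) :
    a * blockStepDensity L Λ w V ≤
      (blockStepDensity L Λ w (V * Pi.mulSingle b (s ^ L))) ^ (1 / 2 : ℝ) *
        (blockStepDensity L Λ w (V * Pi.mulSingle b (s⁻¹ ^ L))) ^ (1 / 2 : ℝ) := by
  set μ : Measure (LGConfig d G) := freeHaarConfig (fineEdges L Λ) with hμ
  set Φ : LGConfig d G → LGConfig d G :=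
    fun U => firstLift L Λ (V * (axialBlockHolonomy L U)⁻¹) * U with hΦ_def
  have hΦ : Measurable Φ :=
    ((measurable_firstLift L Λ).comp
      (measurable_const.mul (measurable_axialBlockHolonomy L).inv)).mul measurable_id
  have hf : Measurable fun U => (w (spreadTwist L b s (Φ U))) ^ (1 / 2 : ℝ) :=
    (hw.comp ((measurable_spreadTwist L b s).comp hΦ)).pow_const _
  have hg : Measurable fun U => (w (spreadTwist L b s⁻¹ (Φ U))) ^ (1 / 2 : ℝ) :=
    (hw.comp ((measurable_spreadTwist L b s⁻¹).comp hΦ)).pow_const _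
  have hsq : ∀ x : ℝ≥0∞, (x ^ (1 / 2 : ℝ)) ^ (2 : ℝ) = x := fun x => by
    rw [← ENNReal.rpow_mul, show (1 / 2 : ℝ) * 2 = 1 by norm_num, ENNReal.rpow_one]
  calc a * blockStepDensity L Λ w V = a * ∫⁻ U, w (Φ U) ∂μ := rfl
    _ = ∫⁻ U, a * w (Φ U) ∂μ := (lintegral_const_mul'' a (hw.comp hΦ).aemeasurable).symm
    _ ≤ ∫⁻ U, ((fun U => (w (spreadTwist L b s (Φ U))) ^ (1 / 2 : ℝ)) *
          (fun U => (w (spreadTwist L b s⁻¹ (Φ U))) ^ (1 / 2 : ℝ))) U ∂μ :=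
        lintegral_mono fun U => hpt (Φ U)
    _ ≤ (∫⁻ U, ((w (spreadTwist L b s (Φ U))) ^ (1 / 2 : ℝ)) ^ (2 : ℝ) ∂μ) ^ (1 / (2 : ℝ)) *
          (∫⁻ U, ((w (spreadTwist L b s⁻¹ (Φ U))) ^ (1 / 2 : ℝ)) ^ (2 : ℝ) ∂μ) ^ (1 / (2 : ℝ)) :=
        ENNReal.lintegral_mul_le_Lp_mul_Lq μ Real.HolderConjugate.two_two hf.aemeasurable
          hg.aemeasurable
    _ = _ := by
        simp only [hsq]
        rw [blockStepDensity_mul_mulSingle_pow L Λ hb s hw V,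
          blockStepDensity_mul_mulSingle_pow L Λ hb s⁻¹ hw V]

end Convexity

/-! ### From the twist inequality to the oscillation bound -/

section Oscillation

/-- **The fibre supremum argument** (abstract form). If a bounded function `f ≥ 0` with
`0 < sup f < ∞` satisfies: for every base point `x₀` and every target `x` there is a companion
point `x'` with `a · f(x₀) ≤ f(x)^{1/2} · f(x')^{1/2}`, then `a² · f(x₀) ≤ f(x)` for ALL `x₀, x` —
i.e. `inf f ≥ a² sup f`. Proof: bound `f(x') ≤ sup f`, square, and take the supremum over `x₀`
(the near-maximiser argument without choosing a maximiser). [folklore] -/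
theorem sq_mul_le_of_forall_exists_sqrt {α : Type*} {f : α → ℝ≥0∞} (hne : (⨆ x, f x) ≠ 0)
    (htop : (⨆ x, f x) ≠ ∞) {a : ℝ≥0∞}
    (h : ∀ x₀ x, ∃ x', a * f x₀ ≤ (f x) ^ (1 / 2 : ℝ) * (f x') ^ (1 / 2 : ℝ)) (x₀ x : α) :
    a ^ 2 * f x₀ ≤ f x := by
  set S := ⨆ x, f x with hS
  have hsq : ∀ z : ℝ≥0∞, (z ^ (1 / 2 : ℝ)) ^ 2 = z := fun z => by
    rw [← ENNReal.rpow_two, ← ENNReal.rpow_mul, show (1 / 2 : ℝ) * 2 = 1 by norm_num,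
      ENNReal.rpow_one]
  -- step 1: `a² f(y)² ≤ f(x) S` for every `y`
  have h1 : ∀ y, a ^ 2 * f y ^ 2 ≤ f x * S := by
    intro y
    obtain ⟨x', hx'⟩ := h y x
    have h2 : a * f y ≤ (f x) ^ (1 / 2 : ℝ) * S ^ (1 / 2 : ℝ) :=
      hx'.trans (mul_le_mul_right (ENNReal.rpow_le_rpow (le_iSup f x') (by norm_num)) _)
    have h3 := pow_le_pow_left' h2 2
    rwa [mul_pow, mul_pow, hsq, hsq] at h3
  -- step 2: `a² S² ≤ f(x) S`
  have h4 : a ^ 2 * S * S ≤ f x * S := by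
    rw [mul_assoc, hS, ENNReal.iSup_mul, ENNReal.mul_iSup]
    refine iSup_le fun y => ?_
    rw [ENNReal.mul_iSup, ENNReal.mul_iSup]
    refine iSup_le fun y' => ?_
    rcases le_total (f y) (f y') with hyy | hyy
    · calc a ^ 2 * (f y * f y') ≤ a ^ 2 * (f y' * f y') := by gcongr
        _ = a ^ 2 * f y' ^ 2 := by rw [sq (f y')]
        _ ≤ f x * ⨆ x, f x := h1 y'
    · calc a ^ 2 * (f y * f y') ≤ a ^ 2 * (f y * f y) := by gcongr
        _ = a ^ 2 * f y ^ 2 := by rw [sq (f y)]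
        _ ≤ f x * ⨆ x, f x := h1 y
  -- step 3: cancel `S` and conclude
  have h5 : a ^ 2 * S ≤ f x := (ENNReal.mul_le_mul_iff_left hne htop).1 h4
  exact (mul_le_mul_right (le_iSup f x₀) _).trans h5

variable [Group G] [MeasurableSpace G] [TopologicalSpace G] [IsTopologicalGroup G]
  [CompactSpace G] [BorelSpace G] [MeasurableMul₂ G] [MeasurableInv G]

omit [MeasurableSpace G] [TopologicalSpace G] [IsTopologicalGroup G] [CompactSpace G] [BorelSpace G]
  [MeasurableMul₂ G] [MeasurableInv G] in
/-- Updating a coordinate and right-multiplying by a one-site configuration. [folklore] -/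
theorem update_mul_mulSingle (V : LGConfig d G) (b : ZdEdge d) (y z : G) :
    update V b y * Pi.mulSingle b z = update V b (y * z) := by
  funext e
  by_cases he : e = b
  · subst he
    rw [Pi.mul_apply, update_self, update_self, Pi.mulSingle_eq_same]
  · rw [Pi.mul_apply, update_of_ne he, update_of_ne he, Pi.mulSingle_eq_of_ne he, mul_one]

/-- **Oscillation bound from the twist inequality.** Let `w` be a measurable weight, bounded
away from `0` and `∞`, such that for every coarse edge `b ∈ Λ` and every target `x ∈ G` there
is an `L`-th root `s` of `x` for which the spread twists by `s` and `s⁻¹` satisfy the pointwise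
geometric-mean bound with constant `e^{-K/2}`. Then the block RG step density changes by at most
the factor `e^{K|F|}` when the coarse field is changed on `F`: per coordinate by the fibre
supremum argument (`sq_mul_le_of_forall_exists_sqrt` applied to `x ↦ D(V[b ↦ x])`, the twist
reaching every target in one step), then coordinate by coordinate. This is the hypothesis `hosc`
of `bounds_of_osc_of_lintegral_eq_one`, here obtained with a constant `K` that is NOT the naive
`β ×` (plaquettes per link) of `blockStepDensity_osc`. [folklore] -/
theorem blockStepDensity_osc_of_twist (L : ℕ) [NeZero L] (Λ : Finset (ZdEdge d))
    {w : LGConfig d G → ℝ≥0∞} (hw : Measurable w)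
    (hpos : ∃ m : ℝ≥0∞, m ≠ 0 ∧ ∀ U, m ≤ w U) (hbdd : ∃ B : ℝ≥0∞, B ≠ ∞ ∧ ∀ U, w U ≤ B)
    {K : ℝ} (hK : 0 ≤ K)
    (htw : ∀ b ∈ Λ, ∀ x : G, ∃ s : G, s ^ L = x ∧ ∀ U,
      ENNReal.ofReal (Real.exp (-(K / 2))) * w U ≤
        (w (spreadTwist L b s U)) ^ (1 / 2 : ℝ) * (w (spreadTwist L b s⁻¹ U)) ^ (1 / 2 : ℝ))
    (F : Finset (ZdEdge d)) (V V' : LGConfig d G) (hV : ∀ e ∉ F, V e = V' e) :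
    blockStepDensity L Λ w V ≤
      ENNReal.ofReal (Real.exp (K * F.card)) * blockStepDensity L Λ w V' := by
  classical
  obtain ⟨m, hm0, hm⟩ := hpos
  obtain ⟨B, hBt, hB⟩ := hbdd
  set D := blockStepDensity L Λ w with hD
  have hexpK : ENNReal.ofReal (Real.exp K) * ENNReal.ofReal (Real.exp (-K)) = 1 := by
    rw [← ENNReal.ofReal_mul (Real.exp_nonneg _), ← Real.exp_add, add_neg_cancel, Real.exp_zero,
      ENNReal.ofReal_one]
  -- per-coordinate comparison
  have hcoord : ∀ (b : ZdEdge d) (V : LGConfig d G) (x₀ x : G),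
      D (update V b x₀) ≤ ENNReal.ofReal (Real.exp K) * D (update V b x) := by
    intro b V x₀ x
    by_cases hb : b ∈ Λ
    · -- the fibre supremum argument
      set f : G → ℝ≥0∞ := fun y => D (update V b y) with hf
      have hne : (⨆ y, f y) ≠ 0 := by
        refine fun h0 => hm0 (le_zero_iff.1 ?_)
        calc m ≤ f 1 := le_blockStepDensity L Λ hm _
          _ ≤ ⨆ y, f y := le_iSup f 1
          _ = 0 := h0
      have htop : (⨆ y, f y) ≠ ∞ :=
        ne_top_of_le_ne_top hBt (iSup_le fun y => blockStepDensity_le L Λ hB _)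
      have hstep : ∀ y₀ y, ∃ y', ENNReal.ofReal (Real.exp (-(K / 2))) * f y₀ ≤
          (f y) ^ (1 / 2 : ℝ) * (f y') ^ (1 / 2 : ℝ) := by
        intro y₀ y
        obtain ⟨s, hsL, hpt⟩ := htw b hb (y₀⁻¹ * y)
        refine ⟨y₀ * s⁻¹ ^ L, ?_⟩
        have h := mul_blockStepDensity_le_sqrt_mul_sqrt L Λ hb s hw hpt (update V b y₀)
        rwa [update_mul_mulSingle, update_mul_mulSingle, hsL, mul_inv_cancel_left] at h
      have hsq := sq_mul_le_of_forall_exists_sqrt hne htop hstep x₀ x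
      rw [← ENNReal.ofReal_pow (Real.exp_nonneg _), ← Real.exp_nat_mul] at hsq
      have hK2 : (2 : ℕ) * -(K / 2) = -K := by push_cast; ring
      rw [hK2] at hsq
      calc f x₀ = ENNReal.ofReal (Real.exp K) * (ENNReal.ofReal (Real.exp (-K)) * f x₀) := by
            rw [← mul_assoc, hexpK, one_mul]
        _ ≤ ENNReal.ofReal (Real.exp K) * f x := mul_le_mul_right hsq _
    · have hne : ∀ b' ∈ Λ, b' ≠ b := fun b' hb' h => hb (h ▸ hb')
      have heq : D (update V b x₀) = D (update V b x) :=
        blockStepDensity_congr L Λ w fun b' hb' => by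
          rw [update_of_ne (hne b' hb'), update_of_ne (hne b' hb')]
      rw [heq]
      refine le_mul_of_one_le_left' ?_
      rw [← ENNReal.ofReal_one]
      exact ENNReal.ofReal_le_ofReal (Real.one_le_exp hK)
  -- coordinate by coordinate
  induction F using Finset.induction_on generalizing V with
  | empty =>
    have : V = V' := funext fun e => hV e (Finset.notMem_empty e)
    simp [this]
  | insert b F₀ hbF ih =>
    set V'' := update V b (V' b) with hV''
    have h1 : D V ≤ ENNReal.ofReal (Real.exp K) * D V'' := by
      have := hcoord b V (V b) (V' b)
      rwa [update_eq_self] at this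
    have h2 : D V'' ≤ ENNReal.ofReal (Real.exp (K * F₀.card)) * D V' := by
      refine ih V'' fun e he => ?_
      by_cases heb : e = b
      · subst heb; rw [hV'', update_self]
      · rw [hV'', update_of_ne heb]
        exact hV e (by simp [heb, he])
    calc D V ≤ ENNReal.ofReal (Real.exp K) * D V'' := h1
      _ ≤ ENNReal.ofReal (Real.exp K) * (ENNReal.ofReal (Real.exp (K * F₀.card)) * D V') :=
          mul_le_mul_right h2 _
      _ = ENNReal.ofReal (Real.exp (K * (insert b F₀).card)) * D V' := by
          rw [← mul_assoc, ← ENNReal.ofReal_mul (Real.exp_nonneg _), ← Real.exp_add,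
            Finset.card_insert_of_notMem hbF]
          congr 3
          push_cast
          ring

end Oscillation

end Literature.MathematicalPhysics.QuantumLattice
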